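import Mathlib
import HarnessLib
import Literature.MathematicalPhysics.QuantumFieldTheory.YangMillsOS
import Literature.Analysis.FunctionSpaces.SchwartzSubspaceBanachSteinhaus
import Summits.QuantumFields.YangMills.Theorems.InfraredLiouvilleStrongCouplingIRTrivialTwoPoint

/-!
# `CurvatureKernelBound` — brick `LatticeSchwingerPairContinuity` (swap-mirror programme toward
# `Stub.FiniteCouplingStrongSubextensive`; crux stmt-QuantumFields-11687,
# line `coupling-trichotomy`, skeleton v9)

**Equicontinuity packaging of the convergence clause of `W₁` (multilinear Banach–Steinhaus on closed
subspaces of `𝓢`).** The crux hypothesis `W₁` gives, for each FIXED pair of real test functions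
`f = ![f₀, f₁]` with an off-diagonal tensor `F = f₀ ⊗ f₁`, convergence of the renormalised lattice
two-point functions
`LS_k(f) = latticeSchwinger r.ρ sch (·.F) k 2 (fun _ => r.curvature) f → S₁ 2 F`.
The programme needs convergence along CONVERGENT SEQUENCES of test functions `g k → g₀`, `h k → h₀`
(in `𝓢`) supported in fixed disjoint closed sets `K₀`, `K₁`:
`LS_k(![g k, h k]) → S₁ 2 (g₀ ⊗ h₀)` (`LatticeSchwingerPairContinuity`).

Route (adapted from the tree's `HypercubicLimit/Negative/ConvergesAlongTests.lean`, same mechanism):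
* the test functions vanishing off a set `K` form a CLOSED submodule of `𝓢(ℝ⁴, ℝ)` (intersection of
  kernels of the continuous point evaluations, `PairContinuity.exists_submodule_vanishingOff`);
  `tsupport f ⊆ K` puts `f` in it, and for closed `K` membership forces `tsupport f ⊆ K`;
* the lattice two-point functional is a finite double sum of products of point evaluations
  (`PairContinuity.latticeSchwinger_two_eq_sum`, from the tree's
  `StrongCouplingIRTrivial.TwoPoint.latticeSchwinger_two_eq`:
  `LS_k(g) = Σ_{x,y} w_k(x,y) g₀(a x) g₁(a y)`, `w_k(x,y) = c_k² a_k⁸ K_k(x,y)` with the centred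
  kernel `K_k`), hence a CONTINUOUS BILINEAR map on the two subspaces;
* real tensors of functions supported in the disjoint closed sets `K₀`, `K₁` are off-diagonal
  (`PairContinuity.isOffDiagonal_tensorFin_two`), so `W₁` is pointwise convergence of these bilinear
  maps on `S_{K₀} × S_{K₁}`;
* `Literature.Analysis.FunctionSpaces.tendsto_apply_of_pointwise_tendsto_schwartzSubmodule`
  (Banach–Steinhaus on the Baire spaces `S_{Kᵢ}`) gives convergence along convergent arguments, and
  `IsTensorOf.unique` identifies the limit tensor. [folklore]
-/

noncomputable section

open scoped BigOperators Topology SchwartzMap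
open MeasureTheory Filter Set
open Literature.MathematicalPhysics.QuantumLattice Literature.MathematicalPhysics.QuantumFieldTheory
  Literature.MathematicalPhysics.AQFT
open Literature.Probability.LatticeModels (Site box)

namespace Summit.QuantumFields.YangMills.Theorems.CurvatureKernel

namespace PairContinuity

/-! ### Closed subspaces of `𝓢(ℝ⁴, ℝ)` cut out by supports -/

/-- The real test functions vanishing off a set `K` form a closed submodule of `𝓢(ℝ⁴, ℝ)`
(an intersection of kernels of continuous point evaluations). [folklore] -/
theorem exists_submodule_vanishingOff (K : Set (EuclideanSpace ℝ (Fin 4))) :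
    ∃ S : Submodule ℝ 𝓢(EuclideanSpace ℝ (Fin 4), ℝ),
      (∀ f, f ∈ S ↔ ∀ y ∉ K, f y = 0) ∧ IsClosed (S : Set 𝓢(EuclideanSpace ℝ (Fin 4), ℝ)) := by
  refine ⟨{ carrier := {f | ∀ y ∉ K, f y = 0}
            add_mem' := fun {f g} hf hg y hy => by
              show f y + g y = 0
              rw [hf y hy, hg y hy, add_zero]
            zero_mem' := fun _ _ => rfl
            smul_mem' := fun c f hf y hy => by
              show c • f y = 0
              rw [hf y hy, smul_zero] }, fun _ => Iff.rfl, ?_⟩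
  -- point evaluations, as continuous linear maps (bounded-continuous-function embedding)
  let ev : EuclideanSpace ℝ (Fin 4) → (𝓢(EuclideanSpace ℝ (Fin 4), ℝ) →L[ℝ] ℝ) := fun p =>
    (BoundedContinuousFunction.evalCLM ℝ p).comp
      (SchwartzMap.toBoundedContinuousFunctionCLM ℝ (EuclideanSpace ℝ (Fin 4)) ℝ)
  have hev : ∀ p (f : 𝓢(EuclideanSpace ℝ (Fin 4), ℝ)), ev p f = f p := fun p f => by
    simp [ev]
  have hset : ({f | ∀ y ∉ K, f y = 0} : Set 𝓢(EuclideanSpace ℝ (Fin 4), ℝ)) =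
      ⋂ y ∈ Kᶜ, (ev y) ⁻¹' {0} := by
    ext f
    simp only [Set.mem_setOf_eq, Set.mem_iInter, Set.mem_preimage, Set.mem_singleton_iff,
      Set.mem_compl_iff, hev]
  show IsClosed ({f | ∀ y ∉ K, f y = 0} : Set 𝓢(EuclideanSpace ℝ (Fin 4), ℝ))
  rw [hset]
  exact isClosed_biInter fun y _ => isClosed_singleton.preimage (ev y).continuous

/-- A test function supported in `K` vanishes off `K`. [folklore] -/
theorem apply_eq_zero_of_tsupport_subset {K : Set (EuclideanSpace ℝ (Fin 4))}
    {f : 𝓢(EuclideanSpace ℝ (Fin 4), ℝ)}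
    (h : tsupport (f : EuclideanSpace ℝ (Fin 4) → ℝ) ⊆ K) : ∀ y ∉ K, f y = 0 :=
  fun _ hy => image_eq_zero_of_notMem_tsupport fun h' => hy (h h')

/-- A test function vanishing off a CLOSED set `K` is supported in `K`. [folklore] -/
theorem tsupport_subset_of_apply_eq_zero {K : Set (EuclideanSpace ℝ (Fin 4))} (hK : IsClosed K)
    {f : 𝓢(EuclideanSpace ℝ (Fin 4), ℝ)} (h : ∀ y ∉ K, f y = 0) :
    tsupport (f : EuclideanSpace ℝ (Fin 4) → ℝ) ⊆ K :=
  closure_minimal (fun y hy => by_contra fun hyK => hy (h y hyK)) hK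

/-- **Disjoint supports ⇒ off-diagonal tensor.** The real two-point tensor
`(ofRealTest φ₀) ⊗ (ofRealTest φ₁)` of test functions supported in disjoint sets `K 0`, `K 1`
vanishes to infinite order on the coincidence locus (its support misses it). [folklore] -/
theorem isOffDiagonal_tensorFin_two {K : Fin 2 → Set (EuclideanSpace ℝ (Fin 4))}
    (hK : Disjoint (K 0) (K 1)) {φ : Fin 2 → 𝓢(EuclideanSpace ℝ (Fin 4), ℝ)}
    (hφ : ∀ i, tsupport (φ i : EuclideanSpace ℝ (Fin 4) → ℝ) ⊆ K i) :
    IsOffDiagonal (SchwartzMap.tensorFin 2 fun i => ofRealTest (φ i)) := by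
  refine IsOffDiagonal.of_tsupport_subset fun x hx hxc => ?_
  -- each coordinate of a point of the support of the tensor lies in the support of the factor
  have hcoord : ∀ i, x i ∈ K i := by
    intro i
    by_contra hi
    have hxi : x i ∈ (tsupport (φ i : EuclideanSpace ℝ (Fin 4) → ℝ))ᶜ := fun h => hi (hφ i h)
    have hopen : IsOpen {z : Fin 2 → EuclideanSpace ℝ (Fin 4) |
        z i ∈ (tsupport (φ i : EuclideanSpace ℝ (Fin 4) → ℝ))ᶜ} :=
      (isClosed_tsupport _).isOpen_compl.preimage (continuous_apply i)
    have hvan : ∀ z ∈ {z : Fin 2 → EuclideanSpace ℝ (Fin 4) |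
        z i ∈ (tsupport (φ i : EuclideanSpace ℝ (Fin 4) → ℝ))ᶜ},
        (SchwartzMap.tensorFin 2 fun i => ofRealTest (φ i)) z = 0 := by
      intro z hz
      rw [SchwartzMap.tensorFin_apply]
      refine Finset.prod_eq_zero (Finset.mem_univ i) ?_
      rw [ofRealTest_apply, image_eq_zero_of_notMem_tsupport hz, Complex.ofReal_zero]
    refine (?_ : x ∉ tsupport ((SchwartzMap.tensorFin 2 fun i => ofRealTest (φ i)) :
      (Fin 2 → EuclideanSpace ℝ (Fin 4)) → ℂ)) hx
    intro hx'
    rw [tsupport, mem_closure_iff] at hx'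
    obtain ⟨z, hzO, hzs⟩ := hx' _ hopen hxi
    exact (Function.mem_support.1 hzs) (hvan z hzO)
  obtain ⟨i, j, hij, hxij⟩ := (mem_coincidenceLocus x).1 hxc
  have h01 : x 0 = x 1 := by
    fin_cases i <;> fin_cases j
    · exact absurd rfl hij
    · exact hxij
    · exact hxij.symm
    · exact absurd rfl hij
  have h0 : x 1 ∈ K 0 := h01 ▸ hcoord 0
  exact Set.disjoint_left.1 hK h0 (hcoord 1)

/-! ### The lattice two-point functional is a continuous bilinear form (finite double sum) -/

section Lattice

variable {G : Type} [Group G] [TopologicalSpace G] [IsTopologicalGroup G] [CompactSpace G]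
  [MeasurableSpace G] [BorelSpace G] {N : ℕ}

/-- **The lattice two-point function as a finite double sum of products of point evaluations.**
For `n = 2` and bounded measurable observables,
`latticeSchwinger ρ sch obs k 2 σ g = Σ_{x,y ∈ box} w(x, y) · g₀(a_k x) g₁(a_k y)` with a weight
`w(x, y) = c₀ c₁ a⁸ K(x, y)` (the tree's centred kernel `K`) independent of `g` — a packaging of
`StrongCouplingIRTrivial.TwoPoint.latticeSchwinger_two_eq`. [folklore] -/
theorem latticeSchwinger_two_eq_sum (ρ : G →* Matrix (Fin N) (Fin N) ℂ) (hρ : Continuous ρ)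
    {ι : Type} (sch : SpeciesScheme ι) (obs : ι → LGConfig 4 G → ℝ) (k : ℕ) (σ : Fin 2 → ι)
    (hmeas : ∀ i, Measurable (obs (σ i))) (hbdd : ∀ i, ∃ C, ∀ U, |obs (σ i) U| ≤ C) :
    ∃ w : Site 4 → Site 4 → ℝ, ∀ g : Fin 2 → 𝓢(EuclideanSpace ℝ (Fin 4), ℝ),
      latticeSchwinger ρ sch obs k 2 σ g =
        ∑ x ∈ box 4 (sch.L k), ∑ y ∈ box 4 (sch.L k),
          w x y * (g 0 (sch.a k • siteToE x) * g 1 (sch.a k • siteToE y)) := by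
  refine ⟨fun x y => sch.c (σ 0) k * sch.c (σ 1) k * sch.a k ^ 8 *
    StrongCouplingIRTrivial.TwoPoint.centredKernel ρ (sch.β k) (sch.side k) (obs (σ 0)) (obs (σ 1))
      (sch.m (σ 0) k) (sch.m (σ 1) k) x y, fun g => ?_⟩
  rw [StrongCouplingIRTrivial.TwoPoint.latticeSchwinger_two_eq ρ hρ sch obs k σ g hmeas hbdd,
    Finset.mul_sum]
  refine Finset.sum_congr rfl fun x _ => ?_
  rw [Finset.mul_sum]
  refine Finset.sum_congr rfl fun y _ => ?_
  ring

end Lattice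

end PairContinuity

open PairContinuity in
/-- **Joint continuity of the lattice two-point limit along convergent test functions with
supports in fixed disjoint closed sets (equicontinuity = multilinear Banach–Steinhaus on closed
subspaces of `𝓢`).** Under the `n = 2` curvature convergence clause of `W₁`, if `g k → g₀` and
`h k → h₀` in `𝓢(ℝ⁴, ℝ)` with `tsupport (g k) ⊆ K₀`, `tsupport (h k) ⊆ K₁` (`K₀`, `K₁` closed and
disjoint), then `LS_k(![g k, h k]) → S₁ 2 F₀` for every tensor `F₀ = g₀ ⊗ h₀`
(REGISTERED signature — do not change). [folklore] -/
theorem LatticeSchwingerPairContinuity : ∀ {G : Type} [Group G] [TopologicalSpace G] [IsTopologicalGroup G] [CompactSpace G] [MeasurableSpace G] [BorelSpace G] (r : Literature.MathematicalPhysics.QuantumFieldTheory.LatticeRep G) (sch : Literature.MathematicalPhysics.QuantumFieldTheory.SpeciesScheme (Literature.MathematicalPhysics.QuantumFieldTheory.YMSpecies G)) (S₁ : Literature.MathematicalPhysics.QuantumLattice.SchwingerFamily (EuclideanSpace ℝ (Fin 4))) (K₀ K₁ : Set (EuclideanSpace ℝ (Fin 4))), IsClosed K₀ → IsClosed K₁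 → Disjoint K₀ K₁ → (∀ (f : Fin 2 → SchwartzMap (EuclideanSpace ℝ (Fin 4)) ℝ) (F : SchwartzMap (Fin 2 → EuclideanSpace ℝ (Fin 4)) ℂ), Literature.MathematicalPhysics.QuantumLattice.IsTensorOf F (fun i => Literature.MathematicalPhysics.QuantumLattice.ofRealTest (f i)) → Literature.MathematicalPhysics.AQFT.IsOffDiagonal F → Filter.Tendsto (fun k : ℕ => ((Literature.MathematicalPhysics.QuantumFieldTheory.latticeSchwinger r.ρ sch (fun s => s.F) k 2 (fun _ => r.curvature) f : ℝ) : ℂ)) Filter.atTop (nhds (S₁ 2 F))) → ∀ (g h : ℕ → SchwartzMap (EuclideanSpace ℝ (Fin 4)) ℝ) (g₀ h₀ : SchwartzMap (EuclideanSpace ℝ (Fin 4)) ℝ), (∀ k, tsupport (g k : EuclideanSpace ℝ (Fin 4) → ℝ) ⊆ K₀) → (∀ k, tsupport (h k : EuclideanSpace ℝ (Fin 4) → ℝ) ⊆ K₁) → Filter.Tendsto g Filter.atTop (nhds g₀) → Filter.Tendsto h Filter.atTop (nhds h₀) → ∀ F₀ : SchwartzMap (Fin 2 → EuclideanSpace ℝ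 (Fin 4)) ℂ, Literature.MathematicalPhysics.QuantumLattice.IsTensorOf F₀ (fun i => Literature.MathematicalPhysics.QuantumLattice.ofRealTest (![g₀, h₀] i)) → Filter.Tendsto (fun k : ℕ => ((Literature.MathematicalPhysics.QuantumFieldTheory.latticeSchwinger r.ρ sch (fun s => s.F) k 2 (fun _ => r.curvature) ![g k, h k] : ℝ) : ℂ)) Filter.atTop (nhds (S₁ 2 F₀)) := by
  intro G _ _ _ _ _ _ r sch S₁ K₀ K₁ hK₀ hK₁ hdisj hW g h g₀ h₀ hg hh hglim hhlim F₀ hF₀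
  -- the two closed sets and the data as `Fin 2`-families
  let K : Fin 2 → Set (EuclideanSpace ℝ (Fin 4)) := ![K₀, K₁]
  have hKc : ∀ i, IsClosed (K i) := fun i => by
    fin_cases i
    · exact hK₀
    · exact hK₁
  have hKd : Disjoint (K 0) (K 1) := hdisj
  let fs : ℕ → Fin 2 → 𝓢(EuclideanSpace ℝ (Fin 4), ℝ) := fun k => ![g k, h k]
  let f₀ : Fin 2 → 𝓢(EuclideanSpace ℝ (Fin 4), ℝ) := ![g₀, h₀]
  have hsupp : ∀ k i, tsupport (fs k i : EuclideanSpace ℝ (Fin 4) → ℝ) ⊆ K i := fun k i => by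
    fin_cases i
    · exact hg k
    · exact hh k
  have hlim : ∀ i, Tendsto (fun k => fs k i) atTop (𝓝 (f₀ i)) := fun i => by
    fin_cases i
    · exact hglim
    · exact hhlim
  -- the closed submodules of functions vanishing off `K i`
  choose Sub hSub using fun i : Fin 2 => exists_submodule_vanishingOff (K i)
  have hSub_mem : ∀ i f, f ∈ Sub i ↔ ∀ y ∉ K i, f y = 0 := fun i => (hSub i).1
  have hSub_closed : ∀ i, IsClosed ((Sub i : Submodule ℝ 𝓢(EuclideanSpace ℝ (Fin 4), ℝ)) :
      Set 𝓢(EuclideanSpace ℝ (Fin 4), ℝ)) := fun i => (hSub i).2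
  have hSub_tsupport : ∀ i (f : 𝓢(EuclideanSpace ℝ (Fin 4), ℝ)), f ∈ Sub i →
      tsupport (f : EuclideanSpace ℝ (Fin 4) → ℝ) ⊆ K i := fun i f hf =>
    tsupport_subset_of_apply_eq_zero (hKc i) ((hSub_mem i f).1 hf)
  -- the lattice two-point functional as a finite double sum (bilinear, continuous)
  have hO : ∀ _i : Fin 2, Measurable ((fun s : YMSpecies G => s.F) ((fun _ => r.curvature) _i)) :=
    fun _ => r.curvature.measurable
  have hOb : ∀ _i : Fin 2,
      ∃ C, ∀ U, |(fun s : YMSpecies G => s.F) ((fun _ => r.curvature) _i) U| ≤ C :=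
    fun _ => r.curvature.bounded
  choose w hw using fun k => latticeSchwinger_two_eq_sum r.ρ r.continuous sch
    (fun s : YMSpecies G => s.F) k (fun _ => r.curvature) hO hOb
  -- point evaluations, as continuous linear maps (bounded-continuous-function embedding)
  let ev : EuclideanSpace ℝ (Fin 4) → (𝓢(EuclideanSpace ℝ (Fin 4), ℝ) →L[ℝ] ℝ) := fun p =>
    (BoundedContinuousFunction.evalCLM ℝ p).comp
      (SchwartzMap.toBoundedContinuousFunctionCLM ℝ (EuclideanSpace ℝ (Fin 4)) ℝ)
  have hev : ∀ p (f : 𝓢(EuclideanSpace ℝ (Fin 4), ℝ)), ev p f = f p := fun p f => by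
    simp [ev]
  have hev_cont : ∀ p, Continuous fun f : 𝓢(EuclideanSpace ℝ (Fin 4), ℝ) => f p := fun p =>
    (ev p).continuous.congr fun f => hev p f
  let pt : ℕ → Site 4 → Site 4 → Fin 2 → EuclideanSpace ℝ (Fin 4) := fun k x y =>
    ![sch.a k • siteToE x, sch.a k • siteToE y]
  let B : ℕ → Site 4 → Site 4 → MultilinearMap ℝ (fun i => ↥(Sub i)) ℝ := fun k x y =>
    (MultilinearMap.mkPiAlgebra ℝ (Fin 2) ℝ).compLinearMap
      (fun i => (ev (pt k x y i)).toLinearMap ∘ₗ (Sub i).subtype)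
  have hB : ∀ k x y (m : ∀ i, ↥(Sub i)), B k x y m =
      ((m 0 : ↥(Sub 0)) : 𝓢(EuclideanSpace ℝ (Fin 4), ℝ)) (sch.a k • siteToE x) *
        ((m 1 : ↥(Sub 1)) : 𝓢(EuclideanSpace ℝ (Fin 4), ℝ)) (sch.a k • siteToE y) := by
    intro k x y m
    simp only [B, MultilinearMap.compLinearMap_apply, MultilinearMap.mkPiAlgebra_apply,
      LinearMap.coe_comp, Function.comp_apply, Submodule.coe_subtype, ContinuousLinearMap.coe_coe,
      hev]
    simp [pt]
  let Tr : ℕ → MultilinearMap ℝ (fun i => ↥(Sub i)) ℝ := fun k =>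
    ∑ x ∈ box 4 (sch.L k), ∑ y ∈ box 4 (sch.L k), w k x y • B k x y
  have hTr_apply : ∀ k (m : ∀ i, ↥(Sub i)), Tr k m =
      latticeSchwinger r.ρ sch (fun s => s.F) k 2 (fun _ => r.curvature)
        (fun i => ((m i : ↥(Sub i)) : 𝓢(EuclideanSpace ℝ (Fin 4), ℝ))) := by
    intro k m
    rw [hw]
    simp [Tr, hB]
  let T : ℕ → MultilinearMap ℝ (fun i => ↥(Sub i)) ℂ := fun k =>
    Complex.ofRealCLM.toLinearMap.compMultilinearMap (Tr k)
  have hT_apply : ∀ k (m : ∀ i, ↥(Sub i)), T k m =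
      ((latticeSchwinger r.ρ sch (fun s => s.F) k 2 (fun _ => r.curvature)
        (fun i => ((m i : ↥(Sub i)) : 𝓢(EuclideanSpace ℝ (Fin 4), ℝ))) : ℝ) : ℂ) := by
    intro k m
    simp only [T, LinearMap.compMultilinearMap_apply, hTr_apply]
    rfl
  have hT_cont : ∀ k, Continuous (T k) := by
    intro k
    have hc : Continuous fun m : ∀ i, ↥(Sub i) =>
        ((latticeSchwinger r.ρ sch (fun s => s.F) k 2 (fun _ => r.curvature)
          (fun i => ((m i : ↥(Sub i)) : 𝓢(EuclideanSpace ℝ (Fin 4), ℝ))) : ℝ) : ℂ) := by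
      refine Complex.continuous_ofReal.comp ?_
      simp only [hw]
      refine continuous_finsetSum _ fun x _ => continuous_finsetSum _ fun y _ =>
        continuous_const.mul (Continuous.mul ?_ ?_)
      · exact (hev_cont _).comp (continuous_subtype_val.comp (continuous_apply 0))
      · exact (hev_cont _).comp (continuous_subtype_val.comp (continuous_apply 1))
    exact hc.congr fun m => (hT_apply k m).symm
  -- pointwise convergence on the subspaces, from the convergence clause of `W₁`
  let Tlim : (∀ i, ↥(Sub i)) → ℂ := fun m =>
    S₁ 2 (SchwartzMap.tensorFin 2 fun i =>
      ofRealTest (((m i : ↥(Sub i)) : 𝓢(EuclideanSpace ℝ (Fin 4), ℝ))))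
  have hT_conv : ∀ m, Tendsto (fun k => T k m) atTop (𝓝 (Tlim m)) := by
    intro m
    have hoff : IsOffDiagonal (SchwartzMap.tensorFin 2 fun i =>
        ofRealTest (((m i : ↥(Sub i)) : 𝓢(EuclideanSpace ℝ (Fin 4), ℝ)))) :=
      isOffDiagonal_tensorFin_two hKd fun i => hSub_tsupport i _ (m i).2
    have h := hW (fun i => ((m i : ↥(Sub i)) : 𝓢(EuclideanSpace ℝ (Fin 4), ℝ))) _
      (isTensorOf_tensorFin _) hoff
    simpa only [hT_apply] using h
  -- the moving arguments in the subspaces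
  have hmem : ∀ k i, fs k i ∈ Sub i := fun k i =>
    (hSub_mem i _).2 (apply_eq_zero_of_tsupport_subset (hsupp k i))
  have hmem₀ : ∀ i, f₀ i ∈ Sub i := fun i =>
    (hSub_closed i).mem_of_tendsto (hlim i) (Eventually.of_forall fun k => hmem k i)
  let X : ℕ → ∀ i, ↥(Sub i) := fun k i => ⟨fs k i, hmem k i⟩
  let X₀ : ∀ i, ↥(Sub i) := fun i => ⟨f₀ i, hmem₀ i⟩
  have hX : Tendsto X atTop (𝓝 X₀) := by
    rw [tendsto_pi_nhds]
    intro i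
    rw [tendsto_subtype_rng]
    exact hlim i
  -- Banach–Steinhaus on the closed subspaces of `𝓢`
  have hmain :=
    Literature.Analysis.FunctionSpaces.tendsto_apply_of_pointwise_tendsto_schwartzSubmodule
      (G := ℂ) Sub hSub_closed T hT_cont Tlim hT_conv hX
  -- identify the limit tensor and the moving arguments
  have hF₀' : F₀ = SchwartzMap.tensorFin 2 fun i => ofRealTest (f₀ i) :=
    hF₀.unique (isTensorOf_tensorFin _)
  have e1 : (fun k => T k (X k)) = fun k : ℕ =>
      ((latticeSchwinger r.ρ sch (fun s => s.F) k 2 (fun _ => r.curvature) ![g k, h k] : ℝ) :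
        ℂ) := by
    funext k
    rw [hT_apply]
  have e2 : Tlim X₀ = S₁ 2 F₀ := by
    rw [hF₀']
  rw [e1, e2] at hmain
  exact hmain

end Summit.QuantumFields.YangMills.Theorems.CurvatureKernel

end
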